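import Summits.BirchSwinnertonDyer.Rank1Residual.Additive.CongruentPartnerMainConjectureX3GordBSD
import Summits.BirchSwinnertonDyer.Rank1Residual.Additive.CongruentPartnerBranchPAdicGrossZagierIffX3
import Summits.BirchSwinnertonDyer.Rank1Residual.Additive.CongruentPartnerBudgetSchemaHolds
import HarnessLib

/-!
# ROUTE G on X3♯(G-ord) ∩ `I₀*` with the budget input SWAPPED for cc-typer-2's T-E3gX3-bud SCHEMA: the
# typed `BudgetLeLambdaAt p W b` of FILES 1–3 is DISCHARGED from Greenberg 1999 Prop. 4.14 BY NAME
# (`p ∤ #E(ℚ)_tors`) + ONE residual Selmer count ((L1)/(L2) DISCHARGED by n1011-p12's theorems)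
# `ResidualSelmerRankGeAt p W b` — so on the X3♯ corner the ONLY unprinted per-pair input left is that count
# (flag `X3-budget-unprinted` rides on `hres` alone) (team n1011, seat n1011-p06 gen 3, row T-E3gX3
# SEQUEL = lead GEN 6 R5-34 "(β) FILE 1 keeps `hbud` as a node input today; swap to cc-typer-2's schema
# in a sequel"; composes FILES 1–3 (p259286 / p260383 / p260447) with cc-typer-2's `CongruentPartnerBudgetSchema.lean` and n1011-p12's `CongruentPartnerBudgetSchemaHolds.lean` BY NAME)

HONEST FRAMING (cell `b2b-bsdres`, run/shared/lean/b2b/bsd-rank1-residual/, verbatim in every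
file): the goal of the cell is to DELETE the COMBINATION-SHAPED residual classes of the
Birch–Swinnerton-Dyer formula for ALL analytic-rank `≤ 1` elliptic curves over `ℚ` — "full BSD
formula for every rank `≤ 1` curve in class `C`" assembled STRICTLY from published theorems — so
that the rank-`≤ 1` remainder becomes exactly the CONSTRUCTION-SHAPED classes, which are TYPED
(missing-input `Prop`s), NOT attempted. This is not "finishing BSD". Team n1011 (RESIDUAL-MAP §I
N10 / O7-ord, X3♯(G-ord) share: REDUCIBLE `E[p]`, additive potentially good ordinary of type (G) at
`p`, defect `e = 2`): research route on a CONSTRUCTION-SHAPED class; no claim beyond stated classes;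
census output = EVIDENCE; X3♯(G-ord) stays CONSTRUCTION-SHAPED; marks UNCHANGED; nothing booked.
THEOREMS ONLY (no definition, no named fact). Named facts enter as HYPOTHESES: `hWu` (Wuthrich 2014
Thm. 16), `h414` (Greenberg 1999 Prop. 4.14 = `Greenberg1999.prop414_noFiniteSubmodule_of_not_dvd_torsionOrder`,
cc-typer-2's record — Hachimori–Matsuno 2000 Cor. (i) is the second source), Delbourgo `hDel`/`hDel3`/
`hDel98`, `hPal` (even arm only), GZK, modularity. The Iwasawa-algebra / control counts (L1)
`card_quotient_eq_pow_lambdaInvariant` and (L2) `card_quotient_eq_card_selmer_torsion` of cc-typer-2's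
schema are THEOREMS of n1011-p12 (`Iwasawa/MuZeroQuotientCard.lean`, `Additive/CongruentPartnerBudgetSchemaHolds.lean`:
`…_holds`, and the binder-free `budgetLeLambdaAt_of_prop414_of_residualSurj''`), so they do NOT appear
here. TYPED per-pair input, BY NAME (NOT re-declared): `hres : ResidualSelmerRankGeAt p W b`
(`p^b ≤ #Sel_{p^∞}(E/ℚ_∞)[p]`-type residual count — the ONE arithmetic input; NO printed discharge on
reducible rows: EPW Cor. 3.2.5 is irreducible-only; to be INSTANTIATED from Greenberg 2010 Prop. 3.2.1
(b) + LEO + μ = 0 — ROUTE-2 II.13.2, LIT-INPUTS-P3 §29), and p10's `BranchUnitCoeffAt W p b` (ENGINE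
value). Row binders: `htors : ¬ p ∣ #E(ℚ)_tors` (route planner 2's census: holds on all 4 098 X3♯
corner rows), `hcm`, `hna`.

## What (pure composition; every step BY NAME)

`budgetLeLambdaAt_of_prop414_of_residualSurj'' p h414 htors hres : BudgetLeLambdaAt p W b`
(cc-typer-2) feeds FILE 1's K-E / K-OUT, FILE 2's rank-`0` ends and FILE 3's rank-`1` capstones:
* §1 `ClassX3Gord.mainConjecture_of_wuthrichHalf_of_coeffCert_of_prop414_of_residualSurj`,
  `ClassX3Gord.quadraticBranchLowerDivisibilityAt_of_wuthrichHalf_of_coeffCert_of_prop414_of_residualSurj`;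
* §2 `ClassX3Gord.bsdp_rankZero_of_wuthrichHalf_of_coeffCert_of_prop414_of_residualSurj_of_nonAnomalous`
  (`p ≥ 5`), `ClassX3Gord.bsdp_three_rankZero_…` (`p = 3`, NO Pal);
* §3 `ClassX3Gord.bsdp_iff_forall_branchPAdicGrossZagier[Odd]At_of_wuthrichHalf_of_coeffCert_of_prop414_of_residualSurj`
  (even; odd `p ≥ 7`) and `…three…` (`p = 3`).
* §4 the `hnf` form (`NoFiniteSubmoduleAt p W` as an explicit binder, for rows with rational `p`-torsion
  where Prop. 4.14 is silent; cc-typer-2 GEN 4 "keep BOTH by name"): K-E and K-OUT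
  `…_of_coeffCert_of_noFiniteSubmodule_of_residualSurj`.
So on an X3♯(G-ord) ∩ `I₀*` row with `p ∤ #E(ℚ)_tors` the Route-G chain reads: Wuthrich Thm. 16 +
Greenberg Prop. 4.14 + [ONE unit coefficient at index `b` + ONE residual count `≥ b`] (+ the rank-one bit /
Delbourgo for the iffs) — the budget is no longer a node input and NO folklore binder remains. Nothing booked.

References: C. Wuthrich, Doc. Math. 19 (2014) Thm. 16 [Wuthrich2014]; R. Greenberg, LNM 1716 (1999)
Prop. 4.14, Lemma 4.6 [GreenbergLNM1716]; Y. Hachimori, K. Matsuno, Proc. AMS 128 (2000) Cor. (i)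
[HachimoriMatsuno2000]; R. Greenberg, Kyoto J. Math. 50 (2010) Prop. 3.2.1 [Greenberg2010] (shape of
the residual input; nothing asserted); D. Delbourgo, J. Number Theory 95 (2002) Thm. (A), (B)
[Delbourgo2002]; R. L. Miller, LMS J. Comput. Math. 14 (2011) Def. 1.1 [Miller2011LMS].
-/

set_option autoImplicit false

noncomputable section

open scoped Classical MatrixGroups ModularForm NumberField

open CongruenceSubgroup WeierstrassCurve NumberField Literature.NumberTheory.EllipticCurves
  Literature.NumberTheory.EllipticCurves.ModularForms
  Literature.NumberTheory.EllipticCurves.Rank1Residual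
  Literature.NumberTheory.EllipticCurves.Rank1Residual.Typed
  Literature.NumberTheory.GaloisRepresentations
  Literature.NumberTheory.EllipticCurves.Wuthrich2014
  Literature.NumberTheory.EllipticCurves.Delbourgo2002
  Summit.BirchSwinnertonDyer.Rank1Residual.AdditivePotMult
  Summit.BirchSwinnertonDyer.Rank1Residual.X1.MuLambda
  Summit.BirchSwinnertonDyer.Rank1Residual.Iwasawa
  IsDedekindDomain

namespace Summit.BirchSwinnertonDyer.Rank1Residual.Additive

variable {W : WeierstrassCurve ℚ} [W.IsElliptic] [W.IsGloballyMinimal] {p : ℕ} [hp : Fact p.Prime]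

/-! ### §1 K-E / K-OUT with the budget from the schema -/

/-- **K-E on X3♯(G-ord) ∩ `I₀*` with the budget DISCHARGED from the schema** (every odd `p`, NO image
hypothesis): Wuthrich half + `BranchUnitCoeffAt W p b` + [Greenberg Prop. 4.14 BY NAME on `p ∤ #E(ℚ)_tors`
+ `ResidualSelmerRankGeAt p W b`] ⟹ for the cyclotomic data, every good-ordinary twist model /
newform / period ratio and every dual datum: `X` torsion, `char_Λ X = (g)`, `ι g = C(u·ϖ)·B`, `μ = 0`,
`λ = b`. [cite: Wuthrich2014, Thm. 16 (p. 397)] [cite: GreenbergLNM1716, Prop. 4.14 (p. 114)]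
[cite: Greenberg2010, Prop. 3.2.1 (shape of the residual input; nothing asserted)] -/
theorem ClassX3Gord.mainConjecture_of_wuthrichHalf_of_coeffCert_of_prop414_of_residualSurj
    (hWu : Wuthrich2014.thm16_halfEigenCharIdeal_dvd_cyclotomicPrime)
    (h414 : Greenberg1999.prop414_noFiniteSubmodule_of_not_dvd_torsionOrder)
    (hp2 : p ≠ 2) (hX : ClassX3Gord W p) (htors : ¬ p ∣ W.torsionOrder)
    {b : ℕ} (hcert : BranchUnitCoeffAt W p b) (hres : ResidualSelmerRankGeAt p W b)
    (V : WeierstrassCurve ℚ) [V.IsElliptic] [V.IsGloballyMinimal] (C : VariableChange ℚ)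
    (hC : C • V.quadraticTwist ((-1 : ℚ) ^ (p / 2) * p) = W) (hV : GoodOrd V p)
    {κ : ZpExtension ℚ p} {γ : Field.absoluteGaloisGroup ℚ} {N : ℕ} [NeZero N]
    {f : CuspForm (Gamma0 N) 2}
    (hκ : κ.IsCyclotomic) (hγ : κ.IsTopGenerator γ) (hcv : IsCyclotomicVariable p γ)
    (hf : IsNewformOf V f) (D : W.SelmerDualData κ γ) (ϖ : ℚ)
    (hϖ : if Even (p / 2) then (ϖ : ℝ) * V.realPeriodRat = plusPeriod f
      else (ϖ : ℝ) * V.imaginaryPeriodRat = minusPeriod f) :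
    D.IsTorsion ∧ ∃ (g : IwasawaAlgebra p) (u : ℤ_[p]ˣ), D.charIdeal = Ideal.span {g} ∧
      iwasawaToPowerSeries p g =
        PowerSeries.C (((u : ℤ_[p]) : ℚ_[p]) * (ϖ : ℚ_[p])) *
          (if Even (p / 2) then padicLFunctionBranch f ((unitRoot V p : ℤ_[p]) : ℚ_[p]) (p / 2)
            else padicLFunctionMinusBranch f ((unitRoot V p : ℤ_[p]) : ℚ_[p]) (p / 2)) ∧
      D.mu = 0 ∧ lambdaInvariant p D.X = b :=
  hX.mainConjecture_of_wuthrichHalf_of_coeffCert_of_budget hWu hp2 hcert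
    (budgetLeLambdaAt_of_prop414_of_residualSurj'' _ h414 htors hres) V C hC hV hκ hγ hcv hf D ϖ hϖ

/-- **K-OUT with the budget from the schema**: X3♯(G-ord) ∩ `I₀*`, every odd `p`: p10's node
`QuadraticBranchLowerDivisibilityAt V p` for EVERY model `V` of `E^{(p*)}` from Wuthrich half + ONE unit
coefficient at index `b` + Prop. 4.14 BY NAME (`p ∤ #E(ℚ)_tors`) + ONE residual count.
[cite: Wuthrich2014, Thm. 16 (p. 397)] [cite: GreenbergLNM1716, Prop. 4.14 (p. 114), §5 (PDF p. 143)] -/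
theorem ClassX3Gord.quadraticBranchLowerDivisibilityAt_of_wuthrichHalf_of_coeffCert_of_prop414_of_residualSurj
    (hWu : Wuthrich2014.thm16_halfEigenCharIdeal_dvd_cyclotomicPrime)
    (h414 : Greenberg1999.prop414_noFiniteSubmodule_of_not_dvd_torsionOrder)
    (hp2 : p ≠ 2) (hX : ClassX3Gord W p) (htors : ¬ p ∣ W.torsionOrder)
    {b : ℕ} (hcert : BranchUnitCoeffAt W p b) (hres : ResidualSelmerRankGeAt p W b)
    (V : WeierstrassCurve ℚ) [V.IsElliptic] [V.IsGloballyMinimal]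
    (hCW : ∃ C : VariableChange ℚ, C • V.quadraticTwist ((-1) ^ (p / 2) * p : ℚ) = W) :
    QuadraticBranchLowerDivisibilityAt V p :=
  hX.quadraticBranchLowerDivisibilityAt_of_wuthrichHalf_of_coeffCert_of_budget hWu hp2 hcert
    (budgetLeLambdaAt_of_prop414_of_residualSurj'' _ h414 htors hres) V hCW

/-! ### §2 Rank `0` ends with the budget from the schema -/

/-- **X3♯(G-ord) ∩ `I₀*`, `p ≥ 5`, `r_an = 0`, non-CM, non-anomalous, `p ∤ #E(ℚ)_tors`: `BSD(E,p)` from the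
named facts (Wuthrich, Greenberg Prop. 4.14, Delbourgo 1998/2002, Pal (even arm), GZK, modularity) +
[ONE unit coefficient at index `b` + ONE residual count `≥ b`]** — FILE 2 §2 with `hbud`
from the schema. [cite: Wuthrich2014, Thm. 16 (p. 397)] [cite: GreenbergLNM1716, Prop. 4.14 (p. 114)]
[cite: Delbourgo2002, Theorem (A), (B) (p. 40)] [cite: Delbourgo1998, Prop. 4 (p. 144)] [cite: Miller2011LMS, §1 and Def. 1.1] -/
theorem ClassX3Gord.bsdp_rankZero_of_wuthrichHalf_of_coeffCert_of_prop414_of_residualSurj_of_nonAnomalous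
    (hWu : Wuthrich2014.thm16_halfEigenCharIdeal_dvd_cyclotomicPrime)
    (h414 : Greenberg1999.prop414_noFiniteSubmodule_of_not_dvd_torsionOrder)
    (hPal : Pal2012.thm32_sqrt_mul_realPeriodRat_twist_eq_of_prime_one_mod_four)
    (hDel98 : Delbourgo1998.prop4_rankZero_pow_dvd_constantCoeff) (hDel : Delbourgo2002.mainTheorem)
    (hGZK : rank_eq_analyticRank_of_analyticRank_le_one) (hmod : hasEntireLFunction_rat)
    (hmodD : nonempty_modularParametrizationData)
    (hX : ClassX3Gord W p) (hcm : ¬ W.HasCM) (hp5 : 5 ≤ p) (he : semistabilityIndex W p = 2)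
    (hr : W.analyticRank = 0) (htors : ¬ p ∣ W.torsionOrder)
    {b : ℕ} (hcert : BranchUnitCoeffAt W p b) (hres : ResidualSelmerRankGeAt p W b)
    (hna : ReductionNonAnomalous W p) : BSDp W p :=
  hX.bsdp_rankZero_of_wuthrichHalf_of_coeffCert_of_budget_of_nonAnomalous hWu hPal hDel98 hDel hGZK hmod
    hmodD hcm hp5 he hr hcert (budgetLeLambdaAt_of_prop414_of_residualSurj'' _ h414 htors hres) hna

/-- **X3♯(G-ord) at `3`, `r_an = 0`, non-CM, non-anomalous, `3 ∤ #E(ℚ)_tors`: `BSD(E,3)`** — FILE 2 §3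
(NO Pal, NO tower, NO image hypothesis) with `hbud` from the schema. [cite: Wuthrich2014, Thm. 16 (p. 397)]
[cite: GreenbergLNM1716, Prop. 4.14 (p. 114)] [cite: Delbourgo2002, Theorem (A), (B) (p. 40), Hypothesis (p. 39)]
[cite: Delbourgo1998, Prop. 4 (p. 144)] [cite: Miller2011LMS, §1 and Def. 1.1] -/
theorem ClassX3Gord.bsdp_three_rankZero_of_wuthrichHalf_of_coeffCert_of_prop414_of_residualSurj_of_nonAnomalous
    [Fact (Nat.Prime 3)] {W : WeierstrassCurve ℚ} [W.IsElliptic] [W.IsGloballyMinimal]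
    (hWu : Wuthrich2014.thm16_halfEigenCharIdeal_dvd_cyclotomicPrime)
    (h414 : Greenberg1999.prop414_noFiniteSubmodule_of_not_dvd_torsionOrder)
    (hDel98 : Delbourgo1998.prop4_rankZero_pow_dvd_constantCoeff)
    (hDel3 : Delbourgo2002.mainTheorem_three)
    (hGZK : rank_eq_analyticRank_of_analyticRank_le_one) (hmod : hasEntireLFunction_rat)
    (hmodD : nonempty_modularParametrizationData)
    (hX : ClassX3Gord W 3) (hcm : ¬ W.HasCM) (hr : W.analyticRank = 0) (htors : ¬ 3 ∣ W.torsionOrder)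
    {b : ℕ} (hcert : BranchUnitCoeffAt W 3 b) (hres : ResidualSelmerRankGeAt 3 W b)
    (hna : ReductionNonAnomalous W 3) : BSDp W 3 :=
  ClassX3Gord.bsdp_three_rankZero_of_wuthrichHalf_of_coeffCert_of_budget_of_nonAnomalous hWu hDel98 hDel3
    hGZK hmod hmodD hX hcm hr hcert (budgetLeLambdaAt_of_prop414_of_residualSurj'' _ h414 htors hres) hna

/-! ### §3 Rank `1` capstones with the budget from the schema -/

/-- **CAPSTONE, even branch, budget from the schema**: X3♯(G-ord) ∩ `I₀*`, `p ≡ 1 (mod 4)`, `r_an = 1`,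
non-CM, non-anomalous, `p ∤ #E(ℚ)_tors`: **`BSD(E,p) ⟺ ∀ (B)-data, BranchPAdicGrossZagierAt`** from Wuthrich +
Delbourgo + Greenberg Prop. 4.14 + [index-`b` unit coefficient + residual count `≥ b` +
`[T¹](ϖ·B) ≠ 0`]. [cite: Delbourgo2002, Theorem (A), (B), Example (p. 40)] [cite: Wuthrich2014, Thm. 16 (p. 397)]
[cite: GreenbergLNM1716, Prop. 4.14 (p. 114)] [cite: Miller2011LMS, Def. 1.1] -/
theorem ClassX3Gord.bsdp_iff_forall_branchPAdicGrossZagierAt_of_wuthrichHalf_of_coeffCert_of_prop414_of_residualSurj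
    (hDel : Delbourgo2002.mainTheorem) (hWu : Wuthrich2014.thm16_halfEigenCharIdeal_dvd_cyclotomicPrime)
    (h414 : Greenberg1999.prop414_noFiniteSubmodule_of_not_dvd_torsionOrder)
    (hmod : hasEntireLFunction_rat) (hmodD : nonempty_modularParametrizationData)
    (hGZK : rank_eq_analyticRank_of_analyticRank_le_one) (hX : ClassX3Gord W p)
    (he : semistabilityIndex W p = 2) (hp4 : p % 4 = 1) (hcm : ¬ W.HasCM) (hna : ReductionNonAnomalous W p)
    (hr : W.analyticRank = 1) (htors : ¬ p ∣ W.torsionOrder)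
    {b : ℕ} (hcert : BranchUnitCoeffAt W p b) (hres : ResidualSelmerRankGeAt p W b)
    (hne : BranchCoeffOneNeZeroAt W p) :
    BSDp W p ↔ ∀ Dh : PAdicHeightData W p, LeadingTermClauses W p Dh → BranchPAdicGrossZagierAt W p Dh :=
  hX.bsdp_iff_forall_branchPAdicGrossZagierAt_of_wuthrichHalf_of_coeffCert_of_budget hDel hWu hmod hmodD hGZK
    he hp4 hcm hna hr hcert (budgetLeLambdaAt_of_prop414_of_residualSurj'' _ h414 htors hres) hne

/-- **CAPSTONE, odd branch `p ≥ 7`, budget from the schema.** [cite: Delbourgo2002, Theorem (A), (B), Example (p. 40)]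
[cite: Wuthrich2014, Thm. 16 (p. 397)] [cite: GreenbergLNM1716, Prop. 4.14 (p. 114)] [cite: Miller2011LMS, Def. 1.1] -/
theorem ClassX3Gord.bsdp_iff_forall_branchPAdicGrossZagierOddAt_of_wuthrichHalf_of_coeffCert_of_prop414_of_residualSurj
    (hDel : Delbourgo2002.mainTheorem) (hWu : Wuthrich2014.thm16_halfEigenCharIdeal_dvd_cyclotomicPrime)
    (h414 : Greenberg1999.prop414_noFiniteSubmodule_of_not_dvd_torsionOrder)
    (hmod : hasEntireLFunction_rat) (hmodD : nonempty_modularParametrizationData)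
    (hGZK : rank_eq_analyticRank_of_analyticRank_le_one) (hX : ClassX3Gord W p)
    (he : semistabilityIndex W p = 2) (hp4 : p % 4 = 3) (hp5 : 5 ≤ p) (hcm : ¬ W.HasCM)
    (hna : ReductionNonAnomalous W p) (hr : W.analyticRank = 1) (htors : ¬ p ∣ W.torsionOrder)
    {b : ℕ} (hcert : BranchUnitCoeffAt W p b) (hres : ResidualSelmerRankGeAt p W b)
    (hne : BranchCoeffOneNeZeroAt W p) :
    BSDp W p ↔
      ∀ Dh : PAdicHeightData W p, LeadingTermClauses W p Dh → BranchPAdicGrossZagierOddAt W p Dh :=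
  hX.bsdp_iff_forall_branchPAdicGrossZagierOddAt_of_wuthrichHalf_of_coeffCert_of_budget hDel hWu hmod hmodD
    hGZK he hp4 hp5 hcm hna hr hcert (budgetLeLambdaAt_of_prop414_of_residualSurj'' _ h414 htors hres) hne

/-- **CAPSTONE, odd branch `p = 3`, budget from the schema** (NO image hypothesis, NO tower).
[cite: Delbourgo2002, Theorem (A), (B) (p. 40)] [cite: Wuthrich2014, Thm. 16 (p. 397)]
[cite: GreenbergLNM1716, Prop. 4.14 (p. 114)] [cite: Miller2011LMS, Def. 1.1] -/
theorem ClassX3Gord.bsdp_three_iff_forall_branchPAdicGrossZagierOddAt_of_wuthrichHalf_of_coeffCert_of_prop414_of_residualSurj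
    (hDel3 : Delbourgo2002.mainTheorem_three)
    (hWu : Wuthrich2014.thm16_halfEigenCharIdeal_dvd_cyclotomicPrime)
    (h414 : Greenberg1999.prop414_noFiniteSubmodule_of_not_dvd_torsionOrder)
    (hmod : hasEntireLFunction_rat) (hmodD : nonempty_modularParametrizationData)
    (hGZK : rank_eq_analyticRank_of_analyticRank_le_one) (hX : ClassX3Gord W 3)
    (hcm : ¬ W.HasCM) (hna : ReductionNonAnomalous W 3) (hr : W.analyticRank = 1)
    (htors : ¬ 3 ∣ W.torsionOrder)
    {b : ℕ} (hcert : BranchUnitCoeffAt W 3 b) (hres : ResidualSelmerRankGeAt 3 W b)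
    (hne : BranchCoeffOneNeZeroAt W 3) :
    BSDp W 3 ↔
      ∀ Dh : PAdicHeightData W 3, LeadingTermClauses W 3 Dh → BranchPAdicGrossZagierOddAt W 3 Dh :=
  hX.bsdp_three_iff_forall_branchPAdicGrossZagierOddAt_of_wuthrichHalf_of_coeffCert_of_budget hDel3 hWu hmod
    hmodD hGZK hcm hna hr hcert (budgetLeLambdaAt_of_prop414_of_residualSurj'' _ h414 htors hres) hne

/-! ### §4 The `hnf` form (rows with a direct no-finite-submodule certificate, e.g. with rational `p`-torsion) -/

/-- **K-E on X3♯(G-ord) ∩ `I₀*` with the budget from (b′) + ONE residual count** (`hnf : NoFiniteSubmoduleAt p W`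
as an explicit binder — for rows where `p ∣ #E(ℚ)_tors`, so that Greenberg's Prop. 4.14 is silent, and a
no-finite-submodule certificate comes from elsewhere; cc-typer-2 GEN 4: "keep BOTH by name"): Wuthrich half
+ `BranchUnitCoeffAt W p b` + `hnf` + `ResidualSelmerRankGeAt p W b` ⟹ the main conjecture on the branch
(n1011-p12's binder-free `budgetLeLambdaAt_of_noFiniteSubmodule_of_residualSurj''`).
[cite: Wuthrich2014, Thm. 16 (p. 397)] [cite: GreenbergLNM1716, Prop. 4.14 and Prop. 4.15 (shape of hnf)]
[cite: Greenberg2010, Prop. 3.2.1 (shape of the residual input; nothing asserted)] -/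
theorem ClassX3Gord.mainConjecture_of_wuthrichHalf_of_coeffCert_of_noFiniteSubmodule_of_residualSurj
    (hWu : Wuthrich2014.thm16_halfEigenCharIdeal_dvd_cyclotomicPrime)
    (hp2 : p ≠ 2) (hX : ClassX3Gord W p) (hnf : NoFiniteSubmoduleAt p W)
    {b : ℕ} (hcert : BranchUnitCoeffAt W p b) (hres : ResidualSelmerRankGeAt p W b)
    (V : WeierstrassCurve ℚ) [V.IsElliptic] [V.IsGloballyMinimal] (C : VariableChange ℚ)
    (hC : C • V.quadraticTwist ((-1 : ℚ) ^ (p / 2) * p) = W) (hV : GoodOrd V p)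
    {κ : ZpExtension ℚ p} {γ : Field.absoluteGaloisGroup ℚ} {N : ℕ} [NeZero N]
    {f : CuspForm (Gamma0 N) 2}
    (hκ : κ.IsCyclotomic) (hγ : κ.IsTopGenerator γ) (hcv : IsCyclotomicVariable p γ)
    (hf : IsNewformOf V f) (D : W.SelmerDualData κ γ) (ϖ : ℚ)
    (hϖ : if Even (p / 2) then (ϖ : ℝ) * V.realPeriodRat = plusPeriod f
      else (ϖ : ℝ) * V.imaginaryPeriodRat = minusPeriod f) :
    D.IsTorsion ∧ ∃ (g : IwasawaAlgebra p) (u : ℤ_[p]ˣ), D.charIdeal = Ideal.span {g} ∧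
      iwasawaToPowerSeries p g =
        PowerSeries.C (((u : ℤ_[p]) : ℚ_[p]) * (ϖ : ℚ_[p])) *
          (if Even (p / 2) then padicLFunctionBranch f ((unitRoot V p : ℤ_[p]) : ℚ_[p]) (p / 2)
            else padicLFunctionMinusBranch f ((unitRoot V p : ℤ_[p]) : ℚ_[p]) (p / 2)) ∧
      D.mu = 0 ∧ lambdaInvariant p D.X = b :=
  hX.mainConjecture_of_wuthrichHalf_of_coeffCert_of_budget hWu hp2 hcert
    (budgetLeLambdaAt_of_noFiniteSubmodule_of_residualSurj'' _ hnf hres) V C hC hV hκ hγ hcv hf D ϖ hϖ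

/-- **K-OUT, `hnf` form**: p10's node `QuadraticBranchLowerDivisibilityAt V p` for EVERY model `V` of
`E^{(p*)}` from Wuthrich half + ONE unit coefficient + (b′) `hnf` + ONE residual count.
[cite: Wuthrich2014, Thm. 16 (p. 397)] [cite: GreenbergLNM1716, Prop. 4.14 and §5 (PDF p. 143)] -/
theorem ClassX3Gord.quadraticBranchLowerDivisibilityAt_of_wuthrichHalf_of_coeffCert_of_noFiniteSubmodule_of_residualSurj
    (hWu : Wuthrich2014.thm16_halfEigenCharIdeal_dvd_cyclotomicPrime)
    (hp2 : p ≠ 2) (hX : ClassX3Gord W p) (hnf : NoFiniteSubmoduleAt p W)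
    {b : ℕ} (hcert : BranchUnitCoeffAt W p b) (hres : ResidualSelmerRankGeAt p W b)
    (V : WeierstrassCurve ℚ) [V.IsElliptic] [V.IsGloballyMinimal]
    (hCW : ∃ C : VariableChange ℚ, C • V.quadraticTwist ((-1) ^ (p / 2) * p : ℚ) = W) :
    QuadraticBranchLowerDivisibilityAt V p :=
  hX.quadraticBranchLowerDivisibilityAt_of_wuthrichHalf_of_coeffCert_of_budget hWu hp2 hcert
    (budgetLeLambdaAt_of_noFiniteSubmodule_of_residualSurj'' _ hnf hres) V hCW

end Summit.BirchSwinnertonDyer.Rank1Residual.Additive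

end
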